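import Summits.ResolutionOfSingularities.ResolutionOfSingularities.Theorems.WildConesCampaignW46HypersurfacesCharTwoHilbertDefs
import Summits.ResolutionOfSingularities.ResolutionOfSingularities.Theorems.WildConesCampaignW46HypersurfacesCharTwoEmbDimStates
import Literature.RingTheory.Length.ColengthFinrank

/-!
# [OURS · L1 W4.6, rung (ii) at p = 2, EVERY dimension n] THE HILBERT FUNCTION OF THE MILNOR ALGEBRA
# AT DEGREE 2 — invariance of `jetThreeColength`, its values in two variables, and the RANGE
# `h₂ ∈ {1, 2, 3}` at embedding dimension `e = 2` (hypersurface double points `z² = a(u₁,…,uₙ)`,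
# every field of characteristic 2)

HONEST FRAMING. Everything here is OURS: theorems about route WildCones' own TYPED point-blow-up
dynamics (`Theorems/WildConesClassicalRegimesDefs.lean`: states `c : (Fin n → ℕ) → κ` = coefficients
of `a(u₁,…,uₙ)` in `z² = a`, `ser` the cleaned series, `MultP` = cleaned order `≥ 2`, `Isol`, `mu`) and
the invariants of `…HypersurfacesCharTwoEmbDimDefs.lean` (p498937: `jetTwoColength`, `milnorEmbDim = e`)
and `…HypersurfacesCharTwoHilbertDefs.lean` (this seat, gen 4: `jetThreeColength f =
dim_κ κ⟦X⟧/((∂f) + 𝔪³)`, `milnorHilbertTwo p n κ c = h₂(c) = jetThreeColength a − jetTwoColength a =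
dim_κ 𝔪_A²/𝔪_A³` for the Milnor algebra `A = κ⟦u⟧/(∂a)`). Nothing here is a statement of
H. Hironaka's manuscript [Hironaka2017] and nothing of it is used; no FACT-LIST premise is used. AI
review is weaker than expert review. Cell res-hironaka (LADDER-RESOLUTION rung L, D-0089), slot W4.6,
seat res-L1-s46-pv-4 (gen 4); host route `WildCones`, crux `ClassicalRegimes`
(stmt-ResolutionOfSingularities-16884, proved); `--supports` that item as a helper.

WHAT IS HERE (first file of the gen-4 package «the case `e = 2`»):

* `finrank_quot_sup_pow_eq_of_quot_equiv`, `jetThreeColength_eq_of_equiv` — `dim_κ A/(I + 𝔪_A^k)`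
  depends only on the `κ`-algebra `A ⧸ I`; so `jetThreeColength` is an invariant of the Milnor algebra
  (series in different numbers of variables allowed), exactly as gen 3's `jetTwoColength_eq_of_equiv`.
* finiteness and monotonicity: `jetTwoColength f ≤ jetThreeColength f` (both quotients are finite).
* TWO VARIABLES (`κ⟦x,y⟧`, `dim κ⟦x,y⟧/𝔪³ = 6` from the tree's `two_mul_finrank_quot_maximalIdeal_pow`):
  `jetThreeColength f ≤ 6`; `= 6` iff both partials lie in `𝔪³`; `≥ 4` when both partials lie in
  `𝔪²`; `≥ 5` when both partials lie in `κ·q + 𝔪³` for one `q ∈ 𝔪²` (the colon count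
  `six_le_finrank_quot_add_card`: each generator `t ∈ 𝔪²` lowers the colength of `(T) + 𝔪³` by at
  most one, `Literature.RingTheory.Length.finrank_quotient_eq_colon_add`).
* THE RANGE (every `n`): for `f` of order `≥ 2` with `jetTwoColength f = 3` (embedding dimension `2`),
  `4 ≤ jetThreeColength f ≤ 6` — by gen 3's residual descent `exists_residual` the Milnor algebra is
  that of a plane germ without `xy`-term; states: a double point with `e(c) = 2` has
  `h₂(c) ∈ {1, 2, 3}` (`milnorHilbertTwo_range`).

References: G.-M. Greuel, G. Pfister, The splitting lemma in any characteristic, J. Algebra 689 (2026)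
= arXiv:2507.17078 [GreuelPfister2026] (through the tree's `exists_residual`); H. Hironaka,
ms. 2017-03-23 [Hironaka2017] — ROLE only (Th. 16.6 p.84, Th. 16.13 p.87), under adjudication.
-/

noncomputable section

-- single-problem summit: the doubled namespace component `ResolutionOfSingularities` is forced
set_option linter.dupNamespace false

open scoped BigOperators Classical

open MvPowerSeries IsLocalRing

open Literature.AlgebraicGeometry.Resolution

namespace Summit.ResolutionOfSingularities.ResolutionOfSingularities.Theorems

namespace CampaignW46.HypersurfacesCharTwo

open WildCones WildCones.MuDropCharTwoOrdP ThreefoldsCharTwo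

variable {κ : Type} [Field κ]

/-! ## The colength of `I + 𝔪^k` is an invariant of the `κ`-algebra `A ⧸ I` -/

/-- For a surjective `κ`-algebra map `K : A → T` of local rings with kernel `I`,
`dim_κ A/(I + 𝔪_A^k) = dim_κ T/𝔪_T^k`. (Gen 3's `finrank_quot_sup_sq_eq_of_surjective` is `k = 2`.)
[folklore] -/
theorem finrank_quot_sup_pow_eq_of_surjective {A T : Type} [CommRing A] [CommRing T] [Algebra κ A]
    [Algebra κ T] [IsLocalRing A] [IsLocalRing T] (K : A →ₐ[κ] T) (hK : Function.Surjective K)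
    (I : Ideal A) (hI : RingHom.ker (K : A →+* T) = I) (k : ℕ) :
    Module.finrank κ (A ⧸ (I ⊔ maximalIdeal A ^ k)) =
      Module.finrank κ (T ⧸ maximalIdeal T ^ k) := by
  obtain ⟨ε⟩ := exists_quot_equiv_of_surjective K hK (I ⊔ maximalIdeal A ^ k)
    (hI.le.trans le_sup_left)
  have hmap : (I ⊔ maximalIdeal A ^ k).map (K : A →+* T) = maximalIdeal T ^ k := by
    rw [Ideal.map_sup, Ideal.map_pow, IsLocalRing.map_maximalIdeal_of_surjective (K : A →+* T) hK,
      (Ideal.map_eq_bot_iff_le_ker (K : A →+* T)).mpr hI.ge, bot_sup_eq]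
  exact (ε.trans (Ideal.quotientEquivAlgOfEq κ hmap)).toLinearEquiv.finrank_eq

/-- **`dim_κ A/(I + 𝔪_A^k)` depends only on the `κ`-algebra `A ⧸ I`** (local `κ`-algebras `A`, `B`,
ideals `I`, `J` with `A ⧸ I ≃ₐ[κ] B ⧸ J`). [folklore] -/
theorem finrank_quot_sup_pow_eq_of_quot_equiv {A B : Type} [CommRing A] [CommRing B] [Algebra κ A]
    [Algebra κ B] [IsLocalRing A] [IsLocalRing B] (I : Ideal A) (J : Ideal B)
    (ε : (A ⧸ I) ≃ₐ[κ] (B ⧸ J)) (k : ℕ) :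
    Module.finrank κ (A ⧸ (I ⊔ maximalIdeal A ^ k)) =
      Module.finrank κ (B ⧸ (J ⊔ maximalIdeal B ^ k)) := by
  by_cases hJ : J = ⊤
  · have hI : I = ⊤ := by
      rw [← Ideal.Quotient.subsingleton_iff] at hJ ⊢
      exact ε.toEquiv.subsingleton
    haveI := Ideal.Quotient.subsingleton_iff.mpr (show I ⊔ maximalIdeal A ^ k = ⊤ by
      rw [hI, top_sup_eq])
    haveI := Ideal.Quotient.subsingleton_iff.mpr (show J ⊔ maximalIdeal B ^ k = ⊤ by
      rw [hJ, top_sup_eq])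
    rw [Module.finrank_zero_of_subsingleton, Module.finrank_zero_of_subsingleton]
  · haveI : Nontrivial (B ⧸ J) := Ideal.Quotient.nontrivial_iff.mpr hJ
    haveI : IsLocalRing (B ⧸ J) :=
      IsLocalRing.of_surjective' (Ideal.Quotient.mk J) Ideal.Quotient.mk_surjective
    let K₁ : A →ₐ[κ] B ⧸ J := (ε : (A ⧸ I) →ₐ[κ] (B ⧸ J)).comp (Ideal.Quotient.mkₐ κ I)
    have hK₁ : Function.Surjective K₁ :=
      ε.surjective.comp (Ideal.Quotient.mkₐ_surjective κ I)
    have hker₁ : RingHom.ker (K₁ : A →+* B ⧸ J) = I := by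
      ext x
      rw [RingHom.mem_ker]
      change ε (Ideal.Quotient.mk I x) = 0 ↔ x ∈ I
      rw [map_eq_zero_iff ε ε.injective, Ideal.Quotient.eq_zero_iff_mem]
    have hker₂ : RingHom.ker (Ideal.Quotient.mkₐ κ J : B →+* B ⧸ J) = J := Ideal.Quotient.mkₐ_ker κ J
    rw [finrank_quot_sup_pow_eq_of_surjective K₁ hK₁ I hker₁,
      finrank_quot_sup_pow_eq_of_surjective (Ideal.Quotient.mkₐ κ J) (Ideal.Quotient.mkₐ_surjective κ J)
        J hker₂]

/-- [OURS · L1 W4.6] **`jetThreeColength` is an invariant of the Milnor algebra**: series in possibly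
different numbers of variables with `κ`-isomorphic Milnor algebras have the same colength of
`(∂f) + 𝔪³`. [folklore] -/
theorem jetThreeColength_eq_of_equiv {n m : ℕ} {f : MvPowerSeries (Fin n) κ}
    {g : MvPowerSeries (Fin m) κ}
    (ε : (MvPowerSeries (Fin n) κ ⧸ Ideal.span (Set.range fun s => MvPowerSeries.pderiv s f)) ≃ₐ[κ]
      (MvPowerSeries (Fin m) κ ⧸ Ideal.span (Set.range fun t => MvPowerSeries.pderiv t g))) :
    jetThreeColength f = jetThreeColength g :=
  finrank_quot_sup_pow_eq_of_quot_equiv _ _ ε 3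

/-! ## Finiteness and monotonicity -/

/-- `κ⟦X₁,…,Xₙ⟧ ⧸ ((∂f) + 𝔪^k)` is finite over `κ`. [folklore] -/
theorem finite_quot_span_pderiv_sup_pow {n : ℕ} (f : MvPowerSeries (Fin n) κ) (k : ℕ) :
    Module.Finite κ (MvPowerSeries (Fin n) κ ⧸
      (Ideal.span (Set.range fun s => MvPowerSeries.pderiv s f) ⊔
        maximalIdeal (MvPowerSeries (Fin n) κ) ^ k)) :=
  finite_quot_mono le_sup_right
    (Literature.RingTheory.MvPowerSeries.Jets.finite_quotient_maximalIdeal_pow k)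

/-- [OURS · L1 W4.6] `jetTwoColength f ≤ jetThreeColength f` (`𝔪³ ≤ 𝔪²`). [folklore] -/
theorem jetTwoColength_le_jetThreeColength {n : ℕ} (f : MvPowerSeries (Fin n) κ) :
    jetTwoColength f ≤ jetThreeColength f := by
  haveI := finite_quot_span_pderiv_sup_pow f 3
  unfold jetTwoColength jetThreeColength
  exact Literature.RingTheory.Length.finrank_quotient_le_of_le
    (sup_le_sup_left (Ideal.pow_le_pow_right (by norm_num)) _)

/-! ## Two variables: the values of `jetThreeColength` -/

section TwoVariables

/-- `dim_κ κ⟦x,y⟧/𝔪³ = 6`. [folklore] -/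
theorem finrank_quot_maximalIdeal_cube_two :
    Module.finrank κ (MvPowerSeries (Fin 2) κ ⧸ maximalIdeal (MvPowerSeries (Fin 2) κ) ^ 3) = 6 := by
  have h := two_mul_finrank_quot_maximalIdeal_pow (κ := κ) 3
  omega

/-- `dim_κ κ⟦x,y⟧/𝔪 = 1`. [folklore] -/
theorem finrank_quot_maximalIdeal_two :
    Module.finrank κ (MvPowerSeries (Fin 2) κ ⧸ maximalIdeal (MvPowerSeries (Fin 2) κ)) = 1 := by
  have h := two_mul_finrank_quot_maximalIdeal_pow (κ := κ) 1
  rw [pow_one] at h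
  omega

/-- The colon count: if `K` has finite colength and `𝔪 · t ⊆ K`, then adjoining `t` lowers the
colength by at most one: `dim κ⟦x,y⟧/K ≤ dim κ⟦x,y⟧/(K + (t)) + 1` (the colon `K : t` contains `𝔪`).
[folklore] -/
theorem finrank_quot_le_finrank_quot_sup_span_add_one {K : Ideal (MvPowerSeries (Fin 2) κ)}
    [Module.Finite κ (MvPowerSeries (Fin 2) κ ⧸ K)] {t : MvPowerSeries (Fin 2) κ}
    (ht : ∀ m ∈ maximalIdeal (MvPowerSeries (Fin 2) κ), m * t ∈ K) :
    Module.finrank κ (MvPowerSeries (Fin 2) κ ⧸ K) ≤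
      Module.finrank κ (MvPowerSeries (Fin 2) κ ⧸ (K ⊔ Ideal.span {t})) + 1 := by
  have h := Literature.RingTheory.Length.finrank_quotient_eq_colon_add (κ := κ) K t
  have hle : maximalIdeal (MvPowerSeries (Fin 2) κ) ≤ K.colon {t} := fun m hm => by
    rw [Submodule.mem_colon_singleton, smul_eq_mul]
    simpa only [mul_comm] using ht m hm
  haveI : Module.Finite κ (MvPowerSeries (Fin 2) κ ⧸ maximalIdeal (MvPowerSeries (Fin 2) κ)) := by
    have := Literature.RingTheory.MvPowerSeries.Jets.finite_quotient_maximalIdeal_pow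
      (σ := Fin 2) (K := κ) 1
    rwa [pow_one] at this
  have h1 := Literature.RingTheory.Length.finrank_quotient_le_of_le (κ := κ) hle
  rw [finrank_quot_maximalIdeal_two] at h1
  omega

/-- **The colon count for `(T) + 𝔪³`**: for a finite set `T ⊆ 𝔪²` of `κ⟦x,y⟧`,
`6 ≤ dim κ⟦x,y⟧/((T) + 𝔪³) + |T|` — each generator lowers the colength by at most one. [folklore] -/
theorem six_le_finrank_quot_add_card (T : Finset (MvPowerSeries (Fin 2) κ))
    (hT : (T : Set (MvPowerSeries (Fin 2) κ)) ⊆ (maximalIdeal (MvPowerSeries (Fin 2) κ) ^ 2 :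
      Ideal (MvPowerSeries (Fin 2) κ))) :
    6 ≤ Module.finrank κ (MvPowerSeries (Fin 2) κ ⧸
      (Ideal.span (T : Set (MvPowerSeries (Fin 2) κ)) ⊔ maximalIdeal (MvPowerSeries (Fin 2) κ) ^ 3)) +
        T.card := by
  induction T using Finset.induction_on with
  | empty =>
    rw [Finset.coe_empty, Ideal.span_empty, bot_sup_eq, Finset.card_empty, add_zero,
      finrank_quot_maximalIdeal_cube_two]
  | @insert t T htT ih =>
    have hT' : (T : Set (MvPowerSeries (Fin 2) κ)) ⊆ (maximalIdeal (MvPowerSeries (Fin 2) κ) ^ 2 :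
        Ideal (MvPowerSeries (Fin 2) κ)) := fun x hx => hT (by simp [hx])
    have ht2 : t ∈ maximalIdeal (MvPowerSeries (Fin 2) κ) ^ 2 := hT (by simp)
    set K : Ideal (MvPowerSeries (Fin 2) κ) :=
      Ideal.span (T : Set (MvPowerSeries (Fin 2) κ)) ⊔ maximalIdeal (MvPowerSeries (Fin 2) κ) ^ 3 with hK
    haveI : Module.Finite κ (MvPowerSeries (Fin 2) κ ⧸ K) := by
      haveI := Literature.RingTheory.MvPowerSeries.Jets.finite_quotient_maximalIdeal_pow
        (σ := Fin 2) (K := κ) 3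
      exact Literature.RingTheory.Length.finite_quotient_of_le (κ := κ) (le_sup_right : _ ≤ K)
    have hK' : Ideal.span ((insert t T : Finset _) : Set (MvPowerSeries (Fin 2) κ)) ⊔
        maximalIdeal (MvPowerSeries (Fin 2) κ) ^ 3 = K ⊔ Ideal.span {t} := by
      rw [Finset.coe_insert, Ideal.span_insert, hK]
      ac_rfl
    have hmt : ∀ m ∈ maximalIdeal (MvPowerSeries (Fin 2) κ), m * t ∈ K := fun m hm => by
      refine Ideal.mem_sup_right ?_
      rw [show (3 : ℕ) = 1 + 2 by norm_num, pow_add, pow_one]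
      exact Ideal.mul_mem_mul hm ht2
    have hstep := finrank_quot_le_finrank_quot_sup_span_add_one (κ := κ) hmt
    rw [hK', Finset.card_insert_of_notMem htT]
    have := ih hT'
    omega

/-- [OURS · L1 W4.6] Two variables: `jetThreeColength f ≤ 6`. [folklore] -/
theorem jetThreeColength_le_six (f : MvPowerSeries (Fin 2) κ) : jetThreeColength f ≤ 6 := by
  haveI := Literature.RingTheory.MvPowerSeries.Jets.finite_quotient_maximalIdeal_pow
    (σ := Fin 2) (K := κ) 3
  rw [← finrank_quot_maximalIdeal_cube_two (κ := κ)]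
  exact Literature.RingTheory.Length.finrank_quotient_le_of_le (κ := κ) le_sup_right

/-- [OURS · L1 W4.6] Two variables: `jetThreeColength f = 6` iff BOTH partials lie in `𝔪³` (the
residual germ has order `≥ 4` modulo squares: no tangent cubic). [folklore] -/
theorem jetThreeColength_eq_six_iff (f : MvPowerSeries (Fin 2) κ) :
    jetThreeColength f = 6 ↔
      ∀ s, MvPowerSeries.pderiv s f ∈ maximalIdeal (MvPowerSeries (Fin 2) κ) ^ 3 := by
  haveI := Literature.RingTheory.MvPowerSeries.Jets.finite_quotient_maximalIdeal_pow
    (σ := Fin 2) (K := κ) 3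
  constructor
  · intro h6 s
    by_contra hs
    have hlt : maximalIdeal (MvPowerSeries (Fin 2) κ) ^ 3 <
        Ideal.span (Set.range fun s => MvPowerSeries.pderiv s f) ⊔
          maximalIdeal (MvPowerSeries (Fin 2) κ) ^ 3 :=
      lt_of_le_of_ne le_sup_right fun heq =>
        hs (heq ▸ Ideal.mem_sup_left (Ideal.subset_span ⟨s, rfl⟩))
    have := Literature.RingTheory.Length.finrank_quotient_lt_of_lt (κ := κ) hlt
    rw [finrank_quot_maximalIdeal_cube_two] at this
    unfold jetThreeColength at h6
    omega
  · intro h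
    have hle : Ideal.span (Set.range fun s => MvPowerSeries.pderiv s f) ≤
        maximalIdeal (MvPowerSeries (Fin 2) κ) ^ 3 := by
      rw [Ideal.span_le]
      rintro _ ⟨s, rfl⟩
      exact h s
    unfold jetThreeColength
    rw [sup_eq_right.mpr hle, finrank_quot_maximalIdeal_cube_two]

/-- [OURS · L1 W4.6] Two variables: if both partials lie in `𝔪²` then `4 ≤ jetThreeColength f`.
[folklore] -/
theorem four_le_jetThreeColength {f : MvPowerSeries (Fin 2) κ}
    (h : ∀ s, MvPowerSeries.pderiv s f ∈ maximalIdeal (MvPowerSeries (Fin 2) κ) ^ 2) :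
    4 ≤ jetThreeColength f := by
  set T : Finset (MvPowerSeries (Fin 2) κ) :=
    Finset.univ.image fun s : Fin 2 => MvPowerSeries.pderiv s f with hT
  have hTsub : (T : Set (MvPowerSeries (Fin 2) κ)) ⊆ (maximalIdeal (MvPowerSeries (Fin 2) κ) ^ 2 :
      Ideal (MvPowerSeries (Fin 2) κ)) := by
    intro x hx
    rw [hT, Finset.coe_image, Finset.coe_univ, Set.image_univ] at hx
    obtain ⟨s, rfl⟩ := hx
    exact h s
  have hspan : Ideal.span (Set.range fun s => MvPowerSeries.pderiv s f) =
      Ideal.span (T : Set (MvPowerSeries (Fin 2) κ)) := by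
    rw [hT, Finset.coe_image, Finset.coe_univ, Set.image_univ]
  have hcard : T.card ≤ 2 := by
    rw [hT]
    exact (Finset.card_image_le).trans (by simp)
  have h6 := six_le_finrank_quot_add_card T hTsub
  unfold jetThreeColength
  rw [hspan]
  omega

/-- [OURS · L1 W4.6] Two variables: if both partials lie in `κ·q + 𝔪³` for ONE element `q ∈ 𝔪²` (a
single quadratic form carries both tangent-cubic partials) then `5 ≤ jetThreeColength f`. [folklore] -/
theorem five_le_jetThreeColength {f : MvPowerSeries (Fin 2) κ} {q : MvPowerSeries (Fin 2) κ}
    (hq : q ∈ maximalIdeal (MvPowerSeries (Fin 2) κ) ^ 2)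
    (h : ∀ s, MvPowerSeries.pderiv s f ∈
      Ideal.span {q} ⊔ maximalIdeal (MvPowerSeries (Fin 2) κ) ^ 3) :
    5 ≤ jetThreeColength f := by
  have h6 := six_le_finrank_quot_add_card (κ := κ) {q} (by simpa using hq)
  rw [Finset.card_singleton, Finset.coe_singleton] at h6
  have hle : Ideal.span (Set.range fun s => MvPowerSeries.pderiv s f) ⊔
      maximalIdeal (MvPowerSeries (Fin 2) κ) ^ 3 ≤
        Ideal.span {q} ⊔ maximalIdeal (MvPowerSeries (Fin 2) κ) ^ 3 := by
    refine sup_le ?_ le_sup_right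
    rw [Ideal.span_le]
    rintro _ ⟨s, rfl⟩
    exact h s
  haveI := finite_quot_span_pderiv_sup_pow f 3
  have hmono := Literature.RingTheory.Length.finrank_quotient_le_of_le (κ := κ) hle
  unfold jetThreeColength
  omega

end TwoVariables

/-! ## The range at embedding dimension two (every `n`) -/

/-- [OURS · L1 W4.6] **THE RANGE OF `h₂` AT `e = 2`** (characteristic two, every `n`): for `f` of
order `≥ 2` with `jetTwoColength f = 3` (embedding dimension `2` of the Milnor algebra),
`4 ≤ jetThreeColength f ≤ 6`, i.e. `h₂ = jetThreeColength f − 3 ∈ {1, 2, 3}`: the residual plane germ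
(gen 3's `exists_residual`, two variables, no `xy`-term) has both partials in `𝔪²`.
[cite: GreuelPfister2026, Thm 3.5 and Cor 3.7] -/
theorem jetThreeColength_range_of_jetTwoColength_eq_three [CharP κ 2] {n : ℕ}
    {f : MvPowerSeries (Fin n) κ} (hf : 2 ≤ f.order) (h3 : jetTwoColength f = 3) :
    4 ≤ jetThreeColength f ∧ jetThreeColength f ≤ 6 := by
  obtain ⟨m, g, -, -, hg, hnp, ⟨ε⟩, -⟩ := exists_residual n f hf
  have hm : m = 2 := by
    have := jetTwoColength_eq_of_residual hg hnp ε
    omega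
  subst hm
  rw [jetThreeColength_eq_of_equiv ε]
  exact ⟨four_le_jetThreeColength
    (pderiv_mem_maximalIdeal_sq ((FormalCoordChange.two_le_order_iff _).mp hg).2 hnp),
    jetThreeColength_le_six g⟩

/-! ## States: `h₂` of a double point with `e = 2` -/

section States

variable {n : ℕ}

/-- [OURS · L1 W4.6] `h₂(c) + (e(c) + 1) = jetThreeColength (ser c)` for a double state (the
subtraction in `milnorHilbertTwo` never truncates). [folklore] -/
theorem milnorHilbertTwo_add [CharP κ 2] {c : (Fin n → ℕ) → κ} (hM : MultP 2 n κ c) :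
    milnorHilbertTwo 2 n κ c + (milnorEmbDim 2 n κ c + 1) = jetThreeColength (ser 2 n κ c) := by
  have h := (milnorEmbDim_le_and_mod_two hM).2.2
  have hle := jetTwoColength_le_jetThreeColength (ser 2 n κ c)
  unfold milnorHilbertTwo
  omega

/-- [OURS · L1 W4.6 rung (ii) at `p = 2`, every dimension; NOT a statement of the manuscript] **THE
RANGE OF `h₂` AT EMBEDDING DIMENSION TWO**: a double state of `z² = a(u₁,…,uₙ)` (any field of
characteristic `2`) with `e(c) = 2` (polar form of corank two) has `h₂(c) ∈ {1, 2, 3}` and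
`jetThreeColength (ser c) = h₂(c) + 3`. [cite: GreuelPfister2026, Thm 3.5 and Cor 3.7] -/
theorem milnorHilbertTwo_range [CharP κ 2] {c : (Fin n → ℕ) → κ} (hM : MultP 2 n κ c)
    (he : milnorEmbDim 2 n κ c = 2) :
    1 ≤ milnorHilbertTwo 2 n κ c ∧ milnorHilbertTwo 2 n κ c ≤ 3 ∧
      jetThreeColength (ser 2 n κ c) = milnorHilbertTwo 2 n κ c + 3 := by
  have h := (milnorEmbDim_le_and_mod_two hM).2.2
  have hadd := milnorHilbertTwo_add hM
  have hr := jetThreeColength_range_of_jetTwoColength_eq_three (two_le_order_ser hM)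
    (by rw [h, he])
  omega

end States

end CampaignW46.HypersurfacesCharTwo

end Summit.ResolutionOfSingularities.ResolutionOfSingularities.Theorems

end
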